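import Summits.CriticalPhenomena.SAWScalingLimit.Theses.SAWZoomRigidity
import Summits.CriticalPhenomena.SAWScalingLimit.Theorems.SAWLeftRightFKGLeftRightFKGStubMeshReduction
import Literature.Probability.RandomPlanarGeometry.ZoomFlow
import Literature.Probability.RandomPlanarGeometry.SAWRestrictionCovariance

/-!
# `SAWZoomRigidity.ZoomInvariantLimitSet` (stmt-CriticalPhenomena-6503): `Ω_SAW` is zoom invariant

Route `SAWZoomRigidity` of `CriticalPhenomena/SAWScalingLimit`, support item
`ZoomInvariantLimitSet` (card item (E1)): the set `Ω_SAW` of joint subsequential scaling limits of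
the critical square-lattice SAW is invariant under every zoom map `Z_r`, `r > 0`. If `P` is a
joint subsequential limit along the meshes `δₙ → 0⁺`, then `P' = Z_r P = P.zoom r`,
`(Z_r P)(D) = (r⁻¹·)_* P(rD)` (`ChordalFamily.zoom`, `ZoomFlow.lean`), is a joint subsequential
limit along `δₙ / r`, and `P (rD) = (r·)_* P'(D)` (`ChordalFamily.zoom_spec`).

## Proof

Everything rests on the EXACT lattice identity behind the dilation covariance of lattice scaling
limits (Lawler–Schramm–Werner 2004, §3.4.3: "the scaling laws tell us that these relations hold
for the maps `z ↦ rz`"): the discretisation of `rΩ` at mesh `δ` IS the discretisation of `Ω` at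
mesh `δ / r` — `meshPoint δ x = r · meshPoint (δ/r) x`, so `meshVertices`, `meshGraph`,
`meshDomain` and `discreteDomainGraph` of `(rΩ, δ)` and `(Ω, δ/r)` coincide
(`discreteDomainGraph_image_similarity`); hence the self-avoiding walks of the two discrete
domains are in a support-preserving bijection (`exists_equiv_of_graph_eq` of the tree's
`Theorems/SAWLeftRightFKGLeftRightFKGStubMeshReduction.lean`), which preserves the weights
`x_c^{|γ|}` and maps polylines to `r ·` polylines, so that for every test function `F`
`∫ F(γ.curve) dP_{rΩ, δ} = ∫ F(r · γ.curve) dP_{Ω, δ/r}` (`integral_curve_law_image_similarity`).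
Endpoint approximations transport by `a'(ε) = a(ε / r)` (`isEndpointApprox_map_similarity`), the
zoom of a chordal family is chordal (`isChordal_zoom`, the a.e. clause pushed through
`ae_map_iff`), and the convergence clause for `P.zoom r` along `δₙ / r` is the convergence clause
for `P` in `rD` along `δₙ` tested against `F ∘ (r⁻¹·)_*` (`isSubseqScalingLimitFamily_zoom`).

References: G. F. Lawler, O. Schramm, W. Werner, *On the scaling limit of planar self-avoiding
walk* (2004), §3.4.2–§3.4.3; S. Smirnov, ICM 2006, §2.
-/

noncomputable section

namespace Summit.CriticalPhenomena.SAWScalingLimit.Theorems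

open MeasureTheory Filter Topology Set
open Literature.Probability.LatticeModels Literature.Probability.RandomPlanarGeometry
open scoped unitInterval ENNReal

namespace ZoomInvariant

/-! ### The discretisation of `rΩ` at mesh `δ` is the discretisation of `Ω` at mesh `δ / r` -/

/-- Mesh points scale: `r · ((δ / r) x) = δ x`. [folklore] -/
theorem similarity_meshPoint_div {r : ℝ} (hr : (r : ℂ) ≠ 0) (δ : ℝ) (x : Site 2) :
    similarity (r : ℂ) hr 0 (meshPoint (δ / r) x) = meshPoint δ x := by
  simp only [similarity_apply, add_zero, meshPoint, Complex.ofReal_div]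
  rw [← mul_assoc, mul_div_cancel₀ _ hr]

/-- The mesh vertices of `(rΩ, δ)` are those of `(Ω, δ / r)`. [folklore] -/
theorem meshVertices_image_similarity {r : ℝ} (hr : (r : ℂ) ≠ 0) (Ω : Set ℂ) (δ : ℝ) :
    meshVertices (similarity (r : ℂ) hr 0 '' Ω) δ = meshVertices Ω (δ / r) := by
  ext x
  rw [mem_meshVertices_iff, mem_meshVertices_iff, ← similarity_meshPoint_div hr δ x,
    (similarity (r : ℂ) hr 0).injective.mem_set_image]

/-- The mesh graph of `(rΩ, δ)` is that of `(Ω, δ / r)` (segments and closures are transported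
by the dilation). [folklore] -/
theorem meshGraph_image_similarity {r : ℝ} (hr : (r : ℂ) ≠ 0) (Ω : Set ℂ) (δ : ℝ) :
    meshGraph (similarity (r : ℂ) hr 0 '' Ω) δ = meshGraph Ω (δ / r) := by
  have hfun : (similarity (r : ℂ) hr 0 : ℂ → ℂ) = fun z => (r : ℂ) * z :=
    funext fun z => by rw [similarity_apply, add_zero]
  ext x y
  rw [meshGraph_adj_iff, meshGraph_adj_iff, ← similarity_meshPoint_div hr δ x,
    ← similarity_meshPoint_div hr δ y]
  simp only [similarity_apply, add_zero]
  rw [LeftRightFKG.CornerLoc.segment_mul, ← hfun, ← (similarity (r : ℂ) hr 0).image_closure,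
    Set.image_subset_image_iff (similarity (r : ℂ) hr 0).injective]

/-- The discrete domain `(rΩ)_δ` is `Ω_{δ/r}` (same lattice sites). [folklore] -/
theorem meshDomain_image_similarity {r : ℝ} (hr : (r : ℂ) ≠ 0) (Ω : Set ℂ) (δ : ℝ) :
    meshDomain (similarity (r : ℂ) hr 0 '' Ω) δ = meshDomain Ω (δ / r) :=
  LeftRightFKG.CornerLoc.meshDomain_congr (meshVertices_image_similarity hr Ω δ)
    (meshGraph_image_similarity hr Ω δ)

/-- **The graph `(rΩ)_δ` is the graph `Ω_{δ/r}`** (isomorphic slit graphs, same sites): the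
exact lattice identity behind the dilation covariance of `δℤ²` scaling limits.
[cite: LawlerSchrammWerner2004SAW, §3.4.3] -/
theorem discreteDomainGraph_image_similarity {r : ℝ} (hr : (r : ℂ) ≠ 0) (Ω : Set ℂ) (δ : ℝ) :
    discreteDomainGraph (similarity (r : ℂ) hr 0 '' Ω) δ = discreteDomainGraph Ω (δ / r) := by
  ext x y
  rw [discreteDomainGraph_adj_iff, discreteDomainGraph_adj_iff, meshGraph_image_similarity hr Ω δ,
    meshDomain_image_similarity hr Ω δ]

/-! ### The critical SAW law of `rΩ` at mesh `δ` is the dilated law of `Ω` at mesh `δ / r` -/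

/-- **Exact zoom covariance of the critical SAW law on the lattice.** For every function `F` on
curve classes, `∫ F(γ.curve) dP_{rΩ, δ, a, b} = ∫ F(r · γ.curve) dP_{Ω, δ/r, a, b}`: the SAWs of
`(rΩ)_δ` and of `Ω_{δ/r}` from `a` to `b` are in a support-preserving bijection
(`discreteDomainGraph_image_similarity`), which preserves the weights `x_c^{|γ|}` (hence `weight`
and its normalisation `law`, junk cases included) and multiplies polylines by `r`.
[cite: LawlerSchrammWerner2004SAW, §3.4.3] -/
theorem integral_curve_law_image_similarity {r : ℝ} (hr : (r : ℂ) ≠ 0) (Ω : Set ℂ) (δ : ℝ)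
    (a b : Site 2) (F : CurveClass ℂ → ℝ) :
    ∫ γ, F γ.curve ∂(SAW.law (similarity (r : ℂ) hr 0 '' Ω) δ a b) =
      ∫ γ, F (CurveClass.map (similarity (r : ℂ) hr 0 : C(ℂ, ℂ)) γ.curve)
        ∂(SAW.law Ω (δ / r) a b) := by
  obtain ⟨e, he⟩ := LeftRightFKG.CornerLoc.exists_equiv_of_graph_eq
    (discreteDomainGraph_image_similarity hr Ω δ).symm a b
  -- the support-preserving bijection, as a measurable equivalence of the discrete spaces
  let em : SAW.DomainSAW Ω (δ / r) a b ≃ᵐ SAW.DomainSAW (similarity (r : ℂ) hr 0 '' Ω) δ a b :=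
    ⟨e, SAW.DomainSAW.measurable_of_top _, SAW.DomainSAW.measurable_of_top _⟩
  have hsupp : ∀ γ, (em γ).walk.support = γ.walk.support := he
  have hlen : ∀ γ, (em γ).length = γ.length := fun γ => by
    have h1 := congrArg List.length (hsupp γ)
    rw [SimpleGraph.Walk.length_support, SimpleGraph.Walk.length_support] at h1
    show (em γ).walk.length = γ.walk.length
    omega
  -- polylines: same support, mesh points `δ x = r · (δ / r) x`
  have hcurve : ∀ γ, (em γ).curve =
      CurveClass.map (similarity (r : ℂ) hr 0 : C(ℂ, ℂ)) γ.curve := fun γ => by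
    show CurveClass.mk ⟨(em γ).walk.toCurve (meshPoint δ)⟩ =
      CurveClass.map (similarity (r : ℂ) hr 0 : C(ℂ, ℂ))
        (CurveClass.mk ⟨γ.walk.toCurve (meshPoint (δ / r))⟩)
    rw [CurveClass.map_mk,
      LeftRightFKG.CornerLoc.toCurve_eq_of_support_eq _ _ (meshPoint δ) (hsupp γ)]
    congr 1
    ext t
    show γ.walk.toCurve (meshPoint δ) t =
      similarity (r : ℂ) hr 0 (γ.walk.toCurve (meshPoint (δ / r)) t)
    rw [LeftRightFKG.CornerLoc.toCurve_meshPoint_apply γ.walk δ t,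
      LeftRightFKG.CornerLoc.toCurve_meshPoint_apply γ.walk (δ / r) t, similarity_apply, add_zero,
      ← mul_assoc, Complex.ofReal_div, mul_div_cancel₀ _ hr]
  -- weights: `x_c ^ |γ|` is preserved
  have hw : ∀ S : Set (SAW.DomainSAW (similarity (r : ℂ) hr 0 '' Ω) δ a b),
      SAW.weight (similarity (r : ℂ) hr 0 '' Ω) δ a b S = SAW.weight Ω (δ / r) a b (em ⁻¹' S) := by
    intro S
    rw [SAW.weight_apply_eq_tsum_indicator, SAW.weight_apply_eq_tsum_indicator]
    refine (Equiv.tsum_eq em.toEquiv _).symm.trans (tsum_congr fun γ => ?_)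
    change S.indicator (fun γ' => ENNReal.ofReal (SAW.criticalFugacity ^ γ'.length)) (em γ) =
      (⇑em ⁻¹' S).indicator (fun γ' => ENNReal.ofReal (SAW.criticalFugacity ^ γ'.length)) γ
    by_cases hγ : em γ ∈ S
    · rw [Set.indicator_of_mem hγ, Set.indicator_of_mem (Set.mem_preimage.2 hγ), hlen]
    · rw [Set.indicator_of_notMem hγ,
        Set.indicator_of_notMem (fun h : γ ∈ ⇑em ⁻¹' S => hγ (Set.mem_preimage.1 h))]
  -- hence the laws correspond (the normalisations agree, junk cases included)
  have hlaw : SAW.law (similarity (r : ℂ) hr 0 '' Ω) δ a b = (SAW.law Ω (δ / r) a b).map em := by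
    ext S hS
    rw [Measure.map_apply em.measurable hS, SAW.law_apply_eq_inv_mul_weight,
      SAW.law_apply_eq_inv_mul_weight, hw S, hw Set.univ, Set.preimage_univ]
  rw [hlaw, integral_map_equiv]
  exact integral_congr_ae (Eventually.of_forall fun γ => congrArg F (hcurve γ))

/-! ### Endpoint approximations, chordality and subsequential limits under the zoom -/

/-- Endpoint approximations transport under `z ↦ r z`: if `a_ε, b_ε` approximate the marked
points of `D`, then `a_{ε/r}, b_{ε/r}` (read at mesh `ε`) approximate those of `rD`. [folklore] -/
theorem isEndpointApprox_map_similarity {D : DobrushinDomain} {a b : ℝ → Site 2}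
    (hab : SAW.IsEndpointApprox D a b) {r : ℝ} (hr0 : 0 < r) (hr : (r : ℂ) ≠ 0) :
    SAW.IsEndpointApprox (D.map (similarity (r : ℂ) hr 0)) (fun ε => a (ε / r))
      (fun ε => b (ε / r)) := by
  have htend : Tendsto (fun ε : ℝ => ε / r) (𝓝[>] (0 : ℝ)) (𝓝[>] (0 : ℝ)) := by
    refine tendsto_nhdsWithin_iff.2 ⟨?_, ?_⟩
    · have h : Tendsto (fun ε : ℝ => ε / r) (𝓝 0) (𝓝 (0 / r)) := tendsto_id.div_const r
      rw [zero_div] at h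
      exact h.mono_left nhdsWithin_le_nhds
    · filter_upwards [self_mem_nhdsWithin] with ε hε
      exact div_pos hε hr0
  have hpt : ∀ (c : ℝ → Site 2) (p : ℂ),
      Tendsto (fun ε => meshPoint ε (c ε)) (𝓝[>] (0 : ℝ)) (𝓝 p) →
        Tendsto (fun ε => meshPoint ε (c (ε / r))) (𝓝[>] (0 : ℝ))
          (𝓝 (similarity (r : ℂ) hr 0 p)) := by
    intro c p hc
    have h := ((similarity (r : ℂ) hr 0).continuous.tendsto p).comp (hc.comp htend)
    refine Filter.Tendsto.congr (fun ε => ?_) h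
    exact similarity_meshPoint_div hr ε (c (ε / r))
  refine ⟨?_, ?_, ?_⟩
  · filter_upwards [htend.eventually hab.reachable] with ε hε
    show (discreteDomainGraph (similarity (r : ℂ) hr 0 '' D.carrier) ε).Reachable (a (ε / r))
      (b (ε / r))
    rwa [discreteDomainGraph_image_similarity]
  · show Tendsto (fun ε => meshPoint ε (a (ε / r))) (𝓝[>] (0 : ℝ))
      (𝓝 (similarity (r : ℂ) hr 0 (D.pt 0)))
    exact hpt a _ hab.tendsto_fst
  · show Tendsto (fun ε => meshPoint ε (b (ε / r))) (𝓝[>] (0 : ℝ))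
      (𝓝 (similarity (r : ℂ) hr 0 (D.pt 1)))
    exact hpt b _ hab.tendsto_snd

/-- `r⁻¹ · (r · z) = z` for the dilations of the zoom flow. [folklore] -/
theorem dil_inv_apply_dil {r : ℝ} (hr : r ≠ 0) (z : ℂ) :
    ChordalFamily.dil r⁻¹ (inv_ne_zero hr) (ChordalFamily.dil r hr z) = z := by
  have hr' : (r : ℂ) ≠ 0 := Complex.ofReal_ne_zero.2 hr
  show ((r⁻¹ : ℝ) : ℂ) * ((r : ℂ) * z + 0) + 0 = z
  rw [add_zero, add_zero, Complex.ofReal_inv, inv_mul_cancel_left₀ hr']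

/-- `(r⁻¹·)_* ∘ (r·)_* = id` on curve classes. [folklore] -/
theorem map_dil_inv_map_dil {r : ℝ} (hr : r ≠ 0) (c : CurveClass ℂ) :
    CurveClass.map (ChordalFamily.dil r⁻¹ (inv_ne_zero hr) : C(ℂ, ℂ))
      (CurveClass.map (ChordalFamily.dil r hr : C(ℂ, ℂ)) c) = c := by
  have h := congrFun (CurveClass.map_homeomorph_trans (ChordalFamily.dil r hr)
    (ChordalFamily.dil r⁻¹ (inv_ne_zero hr))) c
  rw [ChordalFamily.dil_trans_dil_inv hr, CurveClass.map_homeomorph_refl] at h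
  exact h.symm

/-- **The zoom of a chordal family is chordal**: `P.zoom r D = (r⁻¹·)_* P(rD)` is a
probability measure carried by curves from `r⁻¹ (r a) = a` to `b` inside
`r⁻¹ · closure (rD) = closure D`. [folklore] -/
theorem isChordal_zoom {P : ChordalFamily} (hP : P.IsChordal) {r : ℝ} (hr : r ≠ 0) :
    (P.zoom r).IsChordal := by
  intro D
  rw [ChordalFamily.zoom_apply P hr]
  have hgm : Measurable (CurveClass.map (ChordalFamily.dil r⁻¹ (inv_ne_zero hr) : C(ℂ, ℂ))) :=
    measurable_curveClassMap_similarity _ _ _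
  obtain ⟨hprob, hae⟩ := hP (D.map (ChordalFamily.dil r hr))
  refine ⟨Measure.isProbabilityMeasure_map hgm.aemeasurable, ?_⟩
  have hmeas : MeasurableSet {γ : CurveClass ℂ |
      γ.source = D.pt 0 ∧ γ.target = D.pt 1 ∧ γ.range ⊆ closure D.carrier} := by
    rw [Set.setOf_and, Set.setOf_and]
    exact (CurveClass.continuous_source.measurable (measurableSet_singleton _)).inter
      ((CurveClass.continuous_target.measurable (measurableSet_singleton _)).inter
        (CurveClass.measurableSet_rangeSubset isClosed_closure))
  rw [ae_map_iff hgm.aemeasurable hmeas]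
  filter_upwards [hae] with γ hγ
  obtain ⟨hs, ht, hrange⟩ := hγ
  refine ⟨?_, ?_, ?_⟩
  · rw [CurveClass.source_map, hs]
    exact dil_inv_apply_dil hr (D.pt 0)
  · rw [CurveClass.target_map, ht]
    exact dil_inv_apply_dil hr (D.pt 1)
  · rw [CurveClass.range_map, ContinuousMap.coe_coe]
    refine (Set.image_mono hrange).trans ?_
    rw [MarkedDomain.carrier_map, ← Homeomorph.image_closure, Set.image_image]
    rintro _ ⟨x, hx, rfl⟩
    simpa only [dil_inv_apply_dil hr] using hx

/-- **Zooms of subsequential limits are subsequential limits**: if `P` is a joint subsequential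
scaling limit of the critical SAW along `δₙ`, then `P.zoom r` is one along `δₙ / r` (`r > 0`):
the SAW law of `Ω_{δₙ/r}` from `a_{δₙ/r}` to `b_{δₙ/r}`, pushed to curves and dilated by `r`, is
the SAW law of `(rΩ)_{δₙ}` between the same sites (`integral_curve_law_image_similarity`), whose
limit in `rD` is `P (rD)` by hypothesis (tested against `F ∘ (r⁻¹·)_*`).
[cite: LawlerSchrammWerner2004SAW, §3.4.2–§3.4.3] -/
theorem isSubseqScalingLimitFamily_zoom {P : ChordalFamily} {δ : ℕ → ℝ}
    (h : SAW.IsSubseqScalingLimitFamily P δ) {r : ℝ} (hr0 : 0 < r) :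
    SAW.IsSubseqScalingLimitFamily (P.zoom r) (fun n => δ n / r) := by
  have hr : r ≠ 0 := hr0.ne'
  have hrC : (r : ℂ) ≠ 0 := Complex.ofReal_ne_zero.2 hr
  refine ⟨fun n => div_pos (h.pos n) hr0, ?_, fun D a b hab F => ?_⟩
  · simpa using h.tendsto_zero.div_const r
  beta_reduce
  -- the test function pulled back along the inverse dilation `z ↦ r⁻¹ z`
  have hgm : Measurable (CurveClass.map (ChordalFamily.dil r⁻¹ (inv_ne_zero hr) : C(ℂ, ℂ))) :=
    measurable_curveClassMap_similarity _ _ _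
  have hgc : Continuous (CurveClass.map (ChordalFamily.dil r⁻¹ (inv_ne_zero hr) : C(ℂ, ℂ))) :=
    (CurveClass.lipschitzWith_map (lipschitzWith_similarity _ _ _)).continuous
  have key : Tendsto (fun n => ∫ γ, F (CurveClass.map
        (ChordalFamily.dil r⁻¹ (inv_ne_zero hr) : C(ℂ, ℂ)) γ.curve)
          ∂(SAW.law (similarity (r : ℂ) hrC 0 '' D.carrier) (δ n) (a (δ n / r)) (b (δ n / r))))
      atTop (𝓝 (∫ γ, F (CurveClass.map (ChordalFamily.dil r⁻¹ (inv_ne_zero hr) : C(ℂ, ℂ)) γ)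
        ∂(P (D.map (ChordalFamily.dil r hr))))) :=
    h.tendsto_integral (isEndpointApprox_map_similarity hab hr0 hrC)
      (F.compContinuous ⟨CurveClass.map (ChordalFamily.dil r⁻¹ (inv_ne_zero hr) : C(ℂ, ℂ)), hgc⟩)
  rw [ChordalFamily.zoom_apply P hr, integral_map hgm.aemeasurable F.continuous.aestronglyMeasurable]
  refine Filter.Tendsto.congr (fun n => ?_) key
  rw [integral_curve_law_image_similarity hrC D.carrier (δ n) (a (δ n / r)) (b (δ n / r))
    (fun c => F (CurveClass.map (ChordalFamily.dil r⁻¹ (inv_ne_zero hr) : C(ℂ, ℂ)) c))]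
  refine integral_congr_ae (Eventually.of_forall fun γ => ?_)
  exact congrArg F (map_dil_inv_map_dil hr γ.curve)

/-- **`Ω_SAW` is zoom invariant**: `P ∈ Ω_SAW`, `r > 0` ⇒ `P.zoom r ∈ Ω_SAW`. Card item (E1) of
route SAWZoomRigidity. [cite: LawlerSchrammWerner2004SAW, §3.4.2–§3.4.3] -/
theorem zoom_mem_subseqLimitSet {P : ChordalFamily} (hP : P ∈ SAW.subseqLimitSet) {r : ℝ}
    (hr : 0 < r) : P.zoom r ∈ SAW.subseqLimitSet := by
  obtain ⟨hC, δ, hδ⟩ := hP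
  exact ⟨isChordal_zoom hC hr.ne', fun n => δ n / r, isSubseqScalingLimitFamily_zoom hδ hr⟩

end ZoomInvariant

/-- **`SAWZoomRigidity.ZoomInvariantLimitSet` (stmt-CriticalPhenomena-6503) holds.** If `P` is a
chordal joint subsequential scaling limit of the critical `δℤ²` SAW along `δₙ → 0⁺`, then for every
`r > 0` the zoomed family `P' = P.zoom r`, `P' D = (r⁻¹·)_* P(rD)`, is again a chordal joint
subsequential scaling limit (along `δₙ / r`: the discrete domain of `rΩ` at mesh `δ` is the
discrete domain of `Ω` at mesh `δ / r`, weights `x_c^{|γ|}` and polylines transport, endpoint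
approximations transport by `a'(ε) = a(ε / r)`), and `P (rD) = (r·)_* P'(D)` for all `D`
(`ChordalFamily.zoom_spec`). Lawler–Schramm–Werner 2004, §3.4.2–§3.4.3. -/
theorem ZoomInvariantLimitSet_proof :
    Summit.CriticalPhenomena.SAWScalingLimit.Theses.SAWZoomRigidity.ZoomInvariantLimitSet := by
  unfold Summit.CriticalPhenomena.SAWScalingLimit.Theses.SAWZoomRigidity.ZoomInvariantLimitSet
  intro P hP r hr hr0
  have hmem : P.zoom r ∈ SAW.subseqLimitSet := ZoomInvariant.zoom_mem_subseqLimitSet hP hr0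
  exact ⟨P.zoom r, hmem, fun D => P.zoom_spec hr0.ne' D⟩

end Summit.CriticalPhenomena.SAWScalingLimit.Theorems

end
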